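import Mathlib
import Literature.NumberTheory.LFunctions.Zhang2022.Section7cStatements
import Literature.NumberTheory.LFunctions.Zhang2022.Section3MeanValues
import HarnessLib

/-!
# Zhang (2022): the coefficient-generic "b-error chain" toolkit — the two large-sieve displays and the
# Cauchy step of §7 (7.15) / §14 (14.8), proved once for arbitrary coefficients

Topic `Literature/NumberTheory/LFunctions/Zhang2022` (Landau–Siegel audit tree; verdict-neutral).
Y. Zhang, *Discrete mean estimates and the Landau–Siegel zero*, arXiv:2211.02515v1 (2022)
[Zhang2022LandauSiegel] — **an unrefereed manuscript under adjudication**; this THEOREM-ONLY file proves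
classical large-sieve bookkeeping in the manuscript's normalisation and asserts nothing about its
Theorems 1–2, its Proposition 14.1, or Landau–Siegel zeros. ZHANG-L discharge lane, LIB-PLAN §2 items
B1–B3 (helpers under the leaf `Skeleton.Prop141`, nodes `Z22:(14.8)`/`Z22:(14.6)`, GAP row G-adj2-4).

The manuscript proves the error-term estimate (7.11) of Proposition 7.1 by the chain (7.12)–(7.15)
(pp. 37–39) and says of the two `r`-ranges of (14.8) and of (14.6) only "In a way similar to the proof
of Proposition 7.1 … for `D³ ≤ r < 2DP₄` we use the Mellin transform, Lemma 5.4 (i) and the large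
sieve inequality" (p. 79, tex L3960–L3963). The tree proves the §7 chain for the SPECIFIC coefficients
`(κ∗a₁)(dl)` and twist `p^{β₃}` (`Section7cStatements.step7u039_holds`, `Section7cProofs.step7u040_holds`,
`Section7cCauchyStep.step7u041_holds`). This file proves the same three displays for ARBITRARY
coefficients, so that the §14 legs (coefficients `κ*(dl)`, `κ*(D₁dl)` with `|κ*| ≤ Bτ₅`, twist
`χ(p)(pt₀)^β`) and the §12 "as in §7" error terms are instances:

* `largeSieve_dyadic_subset` — the large sieve over the dyadic block of moduli `R ≤ r < 2R`
  (`Section7cStatements.dyadic R`) for a coefficient sequence supported on `W ⊆ (0, N]`: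
  `Σ_{R≤r<2R} Σ*_{θ mod r} |Σ_{n∈W} b(n)θ(n)|² ≤ (N + 1 + 18R²) Σ_{n∈W} |b(n)|²`
  (the tree's `Zhang2022.largeSieve_meanValue`, moduli `⊆ [1, ⌈2R⌉]`).
* `largeSieve_dyadic_primeWindow`, `largeSieve_dyadic_primeWindow_inv` — **§7.u040 generic** (B2):
  for any `b` with `|b(p)| ≤ Mp` on the window `p ∼ P`,
  `Σ_{R≤r<2R} Σ*_θ |Σ_{p∼P} b(p)θ(p)|² ≤ 486M²(R² + P)P³` (and the same with `θ̄ = θ⁻¹`), `D ≥ 3`, `R ≥ 1`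
  [cite: Zhang2022LandauSiegel, §7 p.39, tex L2051].
* `largeSieve_dyadic_natI` — **§7.u039 generic** (B1): for any `c` with `|c(l)| ≤ Kτ_j(l)` on
  `𝔌(y) ∩ ℕ` (`Section7cStatements.natI D y`, `𝔌(y) = [(1/3)Pt₀y, 4Pt₀y]`), any `S ⊆ 𝔌(y) ∩ ℕ`, `σ = 1`:
  `Σ_{R≤r<2R} Σ*_θ |Σ_{l∈S} c(l)θ(l)l^{−s}|² ≤ 57K²·majorantConst(j²,2j)·(log⌊4Pt₀y⌋)^{j²}·(R² + Pt₀y)/(Pt₀y)`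
  [cite: Zhang2022LandauSiegel, §7 p.39, tex L2047]; with `log_natI_length_le` (`y ≤ P ⇒ log⌊4Pt₀y⌋ ≤ 525𝓛⁹`)
  and `ratio_natI_le_two` (`R ≤ y ⇒ (R² + Pt₀y)/(Pt₀y) ≤ 2`) this is `≪ K²𝓛^{9j²}`
  (`largeSieve_dyadic_natI_ell`).
* `sum_le_of_cauchy_integral` — **§7.u041 generic** (B3): Cauchy's inequality in the index inside a
  `t`-integral against `dt/(1+t²)`: mean squares `≤ A²`, `≤ B²` pointwise in `t` and
  `v(x) ≤ W∫F_x G_x dt/(1+t²)` give `Σ_x v(x) ≤ πWAB` [cite: Zhang2022LandauSiegel, §7 p.39, tex L2055];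
  with the shape identities `sqrt_largeSieve_main_le` (`√((R²+P)P³) ≤ RP^{3/2} + P²`) and
  `rpow_neg_three_halves_mul` (`R^{−3/2}·R·(RP^{3/2} + P²) = R^{1/2}P^{3/2} + R^{−1/2}P²`).
* bookkeeping made public once: `sum_prim_eq_sum_sigma`, `mem_dyadic`, `dyadic_subset_Icc`,
  `pos_of_mem_natI`, `le_of_mem_natI`, `natI_subset_Ioc`.

Deliberately NOT here: the Mellin step (the tree's `Section7cMellinStep`, weight-specific), the
`Δ`-localisation `l ∈ 𝔌(Rh)` (Lemma 5.3), the aggregation over `d, h` and the dyadic blocks (LIB-PLAN B4),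
and any §14 object (`TypedSection14*`): the dischargers of the typed §14 legs instantiate this file.

## References

* Y. Zhang, arXiv:2211.02515v1 (2022), §7 pp. 38–39 (7.15), tex L2043–L2058; §14 p. 79 (14.8),
  tex L3956–L3969. [cite: Zhang2022LandauSiegel, §7 pp.38–39; §14 p.79]
* A. C. Cojocaru, M. R. Murty, *An introduction to sieve methods and their applications* (CUP 2005),
  Thm 8.3.1 (the multiplicative large sieve) — through the tree's
  `Literature.NumberTheory.Sieve.LargeSieve.largeSieve_character_nat`. [cite: CojocaruMurty2005, Thm 8.3.1]
-/

noncomputable section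

open Complex Real MeasureTheory
open Literature.NumberTheory.LFunctions.Zhang2022
open Literature.NumberTheory.LFunctions.Zhang2022.Section7cStatements

namespace Literature.NumberTheory.LFunctions.Zhang2022.BErrorChain

/-! ## Bookkeeping on the dyadic block and on `𝔌(y) ∩ ℕ` -/

/-- Membership in the dyadic block: `r ∈ dyadic R` gives `R ≤ r < 2R`.
[cite: Zhang2022LandauSiegel, §7 (7.15) p.38, tex L2025] -/
theorem mem_dyadic {R : ℝ} {r : ℕ} (hr : r ∈ dyadic R) : R ≤ (r : ℝ) ∧ (r : ℝ) < 2 * R :=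
  (Finset.mem_filter.mp hr).2

/-- For `R ≥ 1` the dyadic block lies in `[1, ⌈2R⌉]`.
[cite: Zhang2022LandauSiegel, §7 (7.15) p.38, tex L2025] -/
theorem dyadic_subset_Icc {R : ℝ} (hR : 1 ≤ R) : dyadic R ⊆ Finset.Icc 1 ⌈2 * R⌉₊ := by
  intro r hr
  obtain ⟨hRr, _⟩ := mem_dyadic hr
  have h1 : (1 : ℝ) ≤ r := le_trans hR hRr
  have hrQ : r < ⌈2 * R⌉₊ := Finset.mem_range.mp (Finset.mem_filter.mp hr).1
  exact Finset.mem_Icc.mpr ⟨by exact_mod_cast h1, hrQ.le⟩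

open scoped Classical in
/-- Members of `𝔌(y) ∩ ℕ` are positive. [cite: Zhang2022LandauSiegel, §7 p.38, tex L2033] -/
theorem pos_of_mem_natI {D : ℕ} {y : ℝ} {l : ℕ} (hl : l ∈ natI D y) : 0 < l :=
  (Finset.mem_filter.mp hl).2.1

open scoped Classical in
/-- Members of `𝔌(y) ∩ ℕ` satisfy `(1/3)Pt₀y ≤ l ≤ 4Pt₀y`.
[cite: Zhang2022LandauSiegel, §7 p.38, tex L2033] -/
theorem le_of_mem_natI {D : ℕ} {y : ℝ} {l : ℕ} (hl : l ∈ natI D y) :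
    1 / 3 * Skeleton.bigP D * Skeleton.t0 D * y ≤ l ∧
      (l : ℝ) ≤ 4 * Skeleton.bigP D * Skeleton.t0 D * y :=
  (Finset.mem_filter.mp hl).2.2

open scoped Classical in
/-- `𝔌(y) ∩ ℕ ⊆ (0, ⌊4Pt₀y⌋]`. [cite: Zhang2022LandauSiegel, §7 p.38, tex L2033] -/
theorem natI_subset_Ioc (D : ℕ) (y : ℝ) :
    natI D y ⊆ Finset.Ioc 0 ⌊4 * Skeleton.bigP D * Skeleton.t0 D * y⌋₊ := by
  intro l hl
  have h := Finset.mem_filter.mp hl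
  refine Finset.mem_Ioc.mpr ⟨h.2.1, ?_⟩
  have := Finset.mem_range.mp h.1
  omega

open scoped Classical in
/-- Rewriting the primitive-character double sum `Σ_{R≤r<2R} Σ*_θ` (written with `if θ.IsPrimitive`)
as one sum over the finite set of pairs `(r, θ)`. [cite: Zhang2022LandauSiegel, §7 (7.15) p.38, tex L2025] -/
theorem sum_prim_eq_sum_sigma (R : ℝ) (v : (r : ℕ) → DirichletCharacter ℂ r → ℝ) :
    (∑ r ∈ dyadic R, ∑ θ : DirichletCharacter ℂ r, if θ.IsPrimitive then v r θ else 0) =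
      ∑ x ∈ (dyadic R).sigma (fun r =>
          (Finset.univ : Finset (DirichletCharacter ℂ r)).filter fun θ => θ.IsPrimitive),
        v x.1 x.2 := by
  rw [Finset.sum_sigma]
  exact Finset.sum_congr rfl fun r _ => (Finset.sum_filter _ _).symm

open scoped Classical in
/-- The `if`-form and the `filter`-form of `Σ*_θ` agree.
[cite: Zhang2022LandauSiegel, §7 (7.15) p.38, tex L2025] -/
theorem sum_ite_prim_eq_sum_filter {r : ℕ} (v : DirichletCharacter ℂ r → ℝ) :
    (∑ θ : DirichletCharacter ℂ r, if θ.IsPrimitive then v θ else 0) =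
      ∑ θ : DirichletCharacter ℂ r with θ.IsPrimitive, v θ :=
  (Finset.sum_filter _ _).symm

/-! ## Elementary sizes of the parameters -/

/-- `𝓛 = log D ≥ 1` once `D ≥ 3`. [cite: Zhang2022LandauSiegel, §2 (2.1) p.4] -/
theorem one_le_ell {D : ℕ} (hD : 3 ≤ D) : 1 ≤ Skeleton.ell D := by
  have hD' : (3 : ℝ) ≤ D := by exact_mod_cast hD
  rw [Skeleton.ell, Real.le_log_iff_exp_le (by linarith)]
  exact le_trans (le_of_lt (lt_trans Real.exp_one_lt_d9 (by norm_num))) hD'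

/-- `P = exp(𝓛⁹) ≥ 1`. [cite: Zhang2022LandauSiegel, §2 (2.6) p.4] -/
theorem one_le_bigP (D : ℕ) : 1 ≤ Skeleton.bigP D :=
  Real.one_le_exp (by rw [Skeleton.ell]; positivity)

/-- `t₀ = 𝓛⁵¹⁹ ≥ 1` once `D ≥ 3`. [cite: Zhang2022LandauSiegel, §2 (2.8) p.4] -/
theorem one_le_t0 {D : ℕ} (hD : 3 ≤ D) : 1 ≤ Skeleton.t0 D := by
  rw [Skeleton.t0]; exact one_le_pow₀ (one_le_ell hD)

/-! ## The large sieve on a dyadic block of moduli -/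

open scoped Classical in
/-- **The large sieve on the dyadic block `R ≤ r < 2R`** for coefficients supported on a finite set
`W ⊆ (0, N]`: `Σ_{R≤r<2R} Σ*_{θ mod r} |Σ_{n∈W} b(n)θ(n)|² ≤ (N + 1 + 18R²) Σ_{n∈W} |b(n)|²` (`R ≥ 1`;
the tree's `Zhang2022.largeSieve_meanValue` with moduli `⊆ [1, ⌈2R⌉]`, `⌈2R⌉² ≤ 9R²`).
[cite: Zhang2022LandauSiegel, §3 Lemma 3.3 (ii) p.14] -/
theorem largeSieve_dyadic_subset {R : ℝ} (hR : 1 ≤ R) {N : ℕ} {W : Finset ℕ}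
    (hW : W ⊆ Finset.Ioc 0 N) (b : ℕ → ℂ) :
    (∑ r ∈ dyadic R, ∑ θ : DirichletCharacter ℂ r with θ.IsPrimitive,
        ‖∑ n ∈ W, b n * θ (n : ZMod r)‖ ^ 2) ≤
      ((N : ℝ) + 1 + 18 * R ^ 2) * ∑ n ∈ W, ‖b n‖ ^ 2 := by
  set Q : ℕ := ⌈2 * R⌉₊ with hQ
  set a : ℕ → ℂ := fun n => if n ∈ W then b n else 0 with ha
  have hLS := largeSieve_meanValue (dyadic R) N Q (dyadic_subset_Icc hR) a
  have hlhs : ∀ (r : ℕ) (θ : DirichletCharacter ℂ r),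
      ∑ n ∈ Finset.Ioc 0 N, a n * θ (n : ZMod r) = ∑ n ∈ W, b n * θ (n : ZMod r) := by
    intro r θ
    have hsum : ∑ n ∈ Finset.Ioc 0 N, a n * θ (n : ZMod r) =
        ∑ n ∈ Finset.Ioc 0 N, (if n ∈ W then b n * θ (n : ZMod r) else 0) := by
      refine Finset.sum_congr rfl fun n _ => ?_
      simp only [ha]
      split_ifs <;> simp
    rw [hsum, Finset.sum_ite_mem, Finset.inter_eq_right.mpr hW]
  have hrhs : ∑ n ∈ Finset.Ioc 0 N, ‖a n‖ ^ 2 = ∑ n ∈ W, ‖b n‖ ^ 2 := by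
    have hsum : ∑ n ∈ Finset.Ioc 0 N, ‖a n‖ ^ 2 =
        ∑ n ∈ Finset.Ioc 0 N, (if n ∈ W then ‖b n‖ ^ 2 else 0) := by
      refine Finset.sum_congr rfl fun n _ => ?_
      simp only [ha]
      split_ifs <;> simp
    rw [hsum, Finset.sum_ite_mem, Finset.inter_eq_right.mpr hW]
  simp_rw [hlhs] at hLS
  rw [hrhs] at hLS
  have hQle : (Q : ℝ) ≤ 3 * R := by
    calc (Q : ℝ) ≤ 2 * R + 1 := (Nat.ceil_lt_add_one (by linarith)).le
      _ ≤ 3 * R := by linarith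
  have hQsq : (Q : ℝ) ^ 2 ≤ (3 * R) ^ 2 := by
    have : (0 : ℝ) ≤ Q := Nat.cast_nonneg Q
    gcongr
  have hfac : (N : ℝ) + 1 + 2 * (Q : ℝ) ^ 2 ≤ (N : ℝ) + 1 + 18 * R ^ 2 := by nlinarith
  exact hLS.trans (mul_le_mul_of_nonneg_right hfac (Finset.sum_nonneg fun _ _ => by positivity))

/-! ## B2: the prime-polynomial large sieve with an arbitrary twist (`§7.u040` generic) -/

/-- The window `p ∼ P` lies in `(0, ⌈P(1+𝓛⁻⁶⁸)⌉]`. [cite: Zhang2022LandauSiegel, §2 p.4] -/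
theorem primeWindow_subset_Ioc (D : ℕ) :
    Skeleton.primeWindow D ⊆
      Finset.Ioc 0 ⌈Skeleton.bigP D * (1 + (Skeleton.ell D ^ 68)⁻¹)⌉₊ := by
  intro p hp
  have hp' := Finset.mem_Ioo.mp (Finset.mem_filter.mp hp).1
  exact Finset.mem_Ioc.mpr ⟨by omega, hp'.2.le⟩

/-- `⌈P(1+𝓛⁻⁶⁸)⌉ ≤ 3P` once `D ≥ 3`. [cite: Zhang2022LandauSiegel, §2 p.4] -/
theorem ceil_window_le {D : ℕ} (hD : 3 ≤ D) :
    (⌈Skeleton.bigP D * (1 + (Skeleton.ell D ^ 68)⁻¹)⌉₊ : ℝ) ≤ 3 * Skeleton.bigP D := by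
  have hP1 := one_le_bigP D
  have h68 : (Skeleton.ell D ^ 68)⁻¹ ≤ 1 := inv_le_one_of_one_le₀ (one_le_pow₀ (one_le_ell hD))
  have hx0 : 0 ≤ Skeleton.bigP D * (1 + (Skeleton.ell D ^ 68)⁻¹) := by positivity
  calc (⌈Skeleton.bigP D * (1 + (Skeleton.ell D ^ 68)⁻¹)⌉₊ : ℝ)
      ≤ Skeleton.bigP D * (1 + (Skeleton.ell D ^ 68)⁻¹) + 1 := (Nat.ceil_lt_add_one hx0).le
    _ ≤ Skeleton.bigP D * (1 + 1) + Skeleton.bigP D := by gcongr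
    _ = 3 * Skeleton.bigP D := by ring

open scoped Classical in
/-- **`§7.u040` for an arbitrary twist** (LIB-PLAN B2). For `D ≥ 3`, `R ≥ 1` and any `b` with
`|b(p)| ≤ M·p` on the window `p ∼ P`:
`Σ_{R≤r<2R} Σ*_{θ mod r} |Σ_{p∼P} b(p)θ(p)|² ≤ 486·M²·(R² + P)·P³`.
The manuscript's instances: `b(p) = p^{1+it+β₃}` (§7, `M = 1`) and `b(p) = χ(p)p^{1+it}(pt₀)^β` (§14,
`M = e^{5π}`-type). [cite: Zhang2022LandauSiegel, §7 p.39, tex L2051] -/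
theorem largeSieve_dyadic_primeWindow {D : ℕ} (hD : 3 ≤ D) {R : ℝ} (hR : 1 ≤ R) {M : ℝ}
    (hM : 0 ≤ M) (b : ℕ → ℂ) (hb : ∀ p ∈ Skeleton.primeWindow D, ‖b p‖ ≤ M * p) :
    (∑ r ∈ dyadic R, ∑ θ : DirichletCharacter ℂ r with θ.IsPrimitive,
        ‖∑ p ∈ Skeleton.primeWindow D, b p * θ (p : ZMod r)‖ ^ 2) ≤
      486 * M ^ 2 * (R ^ 2 + Skeleton.bigP D) * Skeleton.bigP D ^ 3 := by
  set P := Skeleton.bigP D with hP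
  set N : ℕ := ⌈Skeleton.bigP D * (1 + (Skeleton.ell D ^ 68)⁻¹)⌉₊ with hN
  have hP1 : 1 ≤ P := one_le_bigP D
  have hW := primeWindow_subset_Ioc D
  have hLS := largeSieve_dyadic_subset hR hW b
  have hNle : (N : ℝ) ≤ 3 * P := ceil_window_le hD
  -- the coefficient sum: `Σ_{p∼P} |b(p)|² ≤ #window · M²N² ≤ N · M² N²`
  have hcard : ((Skeleton.primeWindow D).card : ℝ) ≤ N := by
    have h := Finset.card_le_card hW
    rw [Nat.card_Ioc, Nat.sub_zero] at h
    exact_mod_cast h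
  have hsumb : ∑ p ∈ Skeleton.primeWindow D, ‖b p‖ ^ 2 ≤ (N : ℝ) * (M ^ 2 * (N : ℝ) ^ 2) := by
    calc ∑ p ∈ Skeleton.primeWindow D, ‖b p‖ ^ 2
        ≤ ∑ _p ∈ Skeleton.primeWindow D, M ^ 2 * (N : ℝ) ^ 2 := by
          refine Finset.sum_le_sum fun p hp => ?_
          have hpN : (p : ℝ) ≤ N := by exact_mod_cast (Finset.mem_Ioc.mp (hW hp)).2
          have h1 : ‖b p‖ ≤ M * N := (hb p hp).trans (mul_le_mul_of_nonneg_left hpN hM)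
          calc ‖b p‖ ^ 2 ≤ (M * N) ^ 2 := pow_le_pow_left₀ (norm_nonneg _) h1 2
            _ = M ^ 2 * (N : ℝ) ^ 2 := by ring
      _ = ((Skeleton.primeWindow D).card : ℝ) * (M ^ 2 * (N : ℝ) ^ 2) := by
          rw [Finset.sum_const, nsmul_eq_mul]
      _ ≤ (N : ℝ) * (M ^ 2 * (N : ℝ) ^ 2) := mul_le_mul_of_nonneg_right hcard (by positivity)
  have hfac : (N : ℝ) + 1 + 18 * R ^ 2 ≤ 18 * (R ^ 2 + P) := by linarith
  have hN3 : (N : ℝ) * (M ^ 2 * (N : ℝ) ^ 2) ≤ M ^ 2 * (27 * P ^ 3) := by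
    have h3 : (N : ℝ) ^ 3 ≤ (3 * P) ^ 3 := by gcongr
    calc (N : ℝ) * (M ^ 2 * (N : ℝ) ^ 2) = M ^ 2 * (N : ℝ) ^ 3 := by ring
      _ ≤ M ^ 2 * (3 * P) ^ 3 := by gcongr
      _ = M ^ 2 * (27 * P ^ 3) := by ring
  calc (∑ r ∈ dyadic R, ∑ θ : DirichletCharacter ℂ r with θ.IsPrimitive,
        ‖∑ p ∈ Skeleton.primeWindow D, b p * θ (p : ZMod r)‖ ^ 2)
      ≤ ((N : ℝ) + 1 + 18 * R ^ 2) * ∑ p ∈ Skeleton.primeWindow D, ‖b p‖ ^ 2 := hLS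
    _ ≤ (18 * (R ^ 2 + P)) * (M ^ 2 * (27 * P ^ 3)) :=
        mul_le_mul hfac (hsumb.trans hN3) (Finset.sum_nonneg fun _ _ => by positivity)
          (by positivity)
    _ = 486 * M ^ 2 * (R ^ 2 + P) * P ^ 3 := by ring

open scoped Classical in
/-- Re-indexing `θ ↦ θ̄ = θ⁻¹` in `Σ*_θ`: primitivity is preserved (`conductor_inv`).
[cite: Zhang2022LandauSiegel, §7 p.39, tex L2051] -/
theorem sum_prim_norm_sq_inv_eq {r : ℕ} (F : DirichletCharacter ℂ r → ℂ) :
    (∑ θ : DirichletCharacter ℂ r with θ.IsPrimitive, ‖F θ⁻¹‖ ^ 2) =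
      ∑ θ : DirichletCharacter ℂ r with θ.IsPrimitive, ‖F θ‖ ^ 2 := by
  rw [Finset.sum_filter, Finset.sum_filter,
    ← Equiv.sum_comp (Equiv.inv (DirichletCharacter ℂ r))
      (fun θ : DirichletCharacter ℂ r => if θ.IsPrimitive then ‖F θ‖ ^ 2 else 0)]
  refine Finset.sum_congr rfl fun θ _ => ?_
  have hprim : (θ⁻¹).IsPrimitive ↔ θ.IsPrimitive := by
    rw [DirichletCharacter.isPrimitive_def, DirichletCharacter.isPrimitive_def,
      DirichletCharacter.conductor_inv]
  simp only [Equiv.inv_apply, hprim]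

open scoped Classical in
/-- **`§7.u040` for an arbitrary twist, `θ̄`-form** (the manuscript sums `θ̄(p) = θ⁻¹(p)`): for
`D ≥ 3`, `R ≥ 1`, `|b(p)| ≤ M·p` on `p ∼ P`,
`Σ_{R≤r<2R} Σ*_{θ mod r} |Σ_{p∼P} b(p)θ̄(p)|² ≤ 486·M²·(R² + P)·P³`.
[cite: Zhang2022LandauSiegel, §7 p.39, tex L2051] -/
theorem largeSieve_dyadic_primeWindow_inv {D : ℕ} (hD : 3 ≤ D) {R : ℝ} (hR : 1 ≤ R) {M : ℝ}
    (hM : 0 ≤ M) (b : ℕ → ℂ) (hb : ∀ p ∈ Skeleton.primeWindow D, ‖b p‖ ≤ M * p) :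
    (∑ r ∈ dyadic R, ∑ θ : DirichletCharacter ℂ r with θ.IsPrimitive,
        ‖∑ p ∈ Skeleton.primeWindow D, b p * θ⁻¹ (p : ZMod r)‖ ^ 2) ≤
      486 * M ^ 2 * (R ^ 2 + Skeleton.bigP D) * Skeleton.bigP D ^ 3 := by
  have h := largeSieve_dyadic_primeWindow hD hR hM b hb
  have heq : ∀ r : ℕ, (∑ θ : DirichletCharacter ℂ r with θ.IsPrimitive,
        ‖∑ p ∈ Skeleton.primeWindow D, b p * θ⁻¹ (p : ZMod r)‖ ^ 2) =
      ∑ θ : DirichletCharacter ℂ r with θ.IsPrimitive,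
        ‖∑ p ∈ Skeleton.primeWindow D, b p * θ (p : ZMod r)‖ ^ 2 := fun r =>
    sum_prim_norm_sq_inv_eq (r := r) (fun θ => ∑ p ∈ Skeleton.primeWindow D, b p * θ (p : ZMod r))
  rw [Finset.sum_congr rfl fun r _ => heq r]
  exact h

/-! ## B1: the `l`-polynomial large sieve with divisor-majorant coefficients (`§7.u039` generic) -/

open scoped Classical in
/-- **`§7.u039` for arbitrary coefficients** (LIB-PLAN B1). For `D ≥ 3`, `R ≥ 1`, `y ≥ 1`, a
coefficient sequence `c` with `|c(l)| ≤ K·τ_j(l)` on `𝔌(y) ∩ ℕ` (`𝔌(y) = [(1/3)Pt₀y, 4Pt₀y]`), any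
`S ⊆ 𝔌(y) ∩ ℕ` (e.g. the `l` with `(l,h) = 1`) and any `s` with `σ = 1`:
`Σ_{R≤r<2R} Σ*_{θ mod r} |Σ_{l∈S} c(l)θ(l)l^{−s}|²
  ≤ 57·K²·majorantConst(j²,2j)·(log⌊4Pt₀y⌋)^{j²}·(R² + Pt₀y)/(Pt₀y)`
— the large sieve on the block (length `⌊4Pt₀y⌋`), `|c(l)l^{−s}|² ≤ K²τ_j(l)²·(3/(Pt₀y))·(1/l)` on
`𝔌(y)`, and the divisor count `Σ_{l≤X} τ_j(l)²/l ≤ majorantConst(j²,2j)(log X)^{j²}`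
(`MeanSquareMajorant.sum_tau_sq_div_le`). The manuscript's instances: `c(l) = (κ∗a₁)(dl)`, `y = Rh`
(§7, `K = Bτ₅(d)`, `j = 5`); `c(l) = κ*(dl)` resp. `κ*(D₁dl)` (§14 (14.8)/(14.6)).
[cite: Zhang2022LandauSiegel, §7 p.39, tex L2047] -/
theorem largeSieve_dyadic_natI {D : ℕ} (hD : 3 ≤ D) {R y K : ℝ} (hR : 1 ≤ R) (hy : 1 ≤ y)
    (j : ℕ) {c : ℕ → ℂ}
    (hc : ∀ l ∈ natI D y, ‖c l‖ ≤ K * MeanSquareMajorant.tau j l)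
    {S : Finset ℕ} (hS : S ⊆ natI D y) {s : ℂ} (hs : s.re = 1) :
    (∑ r ∈ dyadic R, ∑ θ : DirichletCharacter ℂ r with θ.IsPrimitive,
        ‖∑ l ∈ S, c l * θ (l : ZMod r) * (l : ℂ) ^ (-s)‖ ^ 2) ≤
      57 * K ^ 2 * MeanSquareMajorant.majorantConst (j ^ 2) (2 * j) *
        Real.log (⌊4 * Skeleton.bigP D * Skeleton.t0 D * y⌋₊ : ℕ) ^ (j ^ 2) *
        ((R ^ 2 + Skeleton.bigP D * Skeleton.t0 D * y) / (Skeleton.bigP D * Skeleton.t0 D * y)) := by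
  set Kc := MeanSquareMajorant.majorantConst (j ^ 2) (2 * j) with hKc
  have hKc0 : 0 < Kc := MeanSquareMajorant.majorantConst_pos _ _
  set P := Skeleton.bigP D with hPdef
  set T₀ := Skeleton.t0 D with hT₀
  set L := P * T₀ * y with hLdef
  have hP1 : 1 ≤ P := one_le_bigP D
  have hT1 : 1 ≤ T₀ := one_le_t0 hD
  have hL1 : 1 ≤ L := by
    have h1 : (1 : ℝ) ≤ P * T₀ := one_le_mul_of_one_le_of_one_le hP1 hT1
    exact one_le_mul_of_one_le_of_one_le h1 hy
  have hL0 : 0 < L := by linarith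
  have hR0 : 0 ≤ R := by linarith
  -- the large sieve on the block
  set N : ℕ := ⌊4 * Skeleton.bigP D * Skeleton.t0 D * y⌋₊ with hN
  have hSN : S ⊆ Finset.Ioc 0 N := hS.trans (natI_subset_Ioc D y)
  set b : ℕ → ℂ := fun l => c l * (l : ℂ) ^ (-s) with hb
  have hLS := largeSieve_dyadic_subset hR hSN b
  have hlhs : (∑ r ∈ dyadic R, ∑ θ : DirichletCharacter ℂ r with θ.IsPrimitive,
        ‖∑ l ∈ S, c l * θ (l : ZMod r) * (l : ℂ) ^ (-s)‖ ^ 2) =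
      ∑ r ∈ dyadic R, ∑ θ : DirichletCharacter ℂ r with θ.IsPrimitive,
        ‖∑ l ∈ S, b l * θ (l : ZMod r)‖ ^ 2 := by
    refine Finset.sum_congr rfl fun r _ => Finset.sum_congr rfl fun θ _ => ?_
    congr 2
    exact Finset.sum_congr rfl fun l _ => by simp only [hb]; ring
  -- the coefficients: `‖b(l)‖² ≤ K²·(3/L)·τ_j(l)²/l` on `𝔌(y)`
  have hcoef : ∀ l ∈ S, ‖b l‖ ^ 2 ≤ K ^ 2 * (3 / L) * (MeanSquareMajorant.tau j l ^ 2 / l) := by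
    intro l hl
    have hlI := hS hl
    have hl0 : 0 < l := pos_of_mem_natI hlI
    have hl' : (0 : ℝ) < l := by exact_mod_cast hl0
    have hlL : L ≤ 3 * l := by
      have h1 := (le_of_mem_natI hlI).1
      have : L = 3 * (1 / 3 * Skeleton.bigP D * Skeleton.t0 D * y) := by rw [hLdef]; ring
      linarith
    simp only [hb]
    rw [norm_mul, mul_pow, Complex.norm_natCast_cpow_of_pos hl0]
    have hre : (-s).re = -1 := by simp [hs]
    rw [hre, Real.rpow_neg_one]
    have h1 : ‖c l‖ ≤ K * MeanSquareMajorant.tau j l := hc l hlI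
    have h2 : ‖c l‖ ^ 2 ≤ (K * MeanSquareMajorant.tau j l) ^ 2 :=
      pow_le_pow_left₀ (norm_nonneg _) h1 2
    have h3 : ((l : ℝ)⁻¹) ^ 2 ≤ (3 / L) * (1 / l) := by
      rw [inv_pow, ← one_div, div_mul_div_comm, mul_one,
        div_le_div_iff₀ (by positivity) (by positivity)]
      nlinarith
    calc ‖c l‖ ^ 2 * ((l : ℝ)⁻¹) ^ 2
        ≤ (K * MeanSquareMajorant.tau j l) ^ 2 * ((3 / L) * (1 / l)) :=
          mul_le_mul h2 h3 (by positivity) (by positivity)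
      _ = K ^ 2 * (3 / L) * (MeanSquareMajorant.tau j l ^ 2 / l) := by ring
  -- the coefficient sum
  have hN2 : 2 ≤ N := by
    rw [hN]
    apply Nat.le_floor
    push_cast
    nlinarith [hP1, hT1, hy]
  have hsumb : ∑ l ∈ S, ‖b l‖ ^ 2 ≤ K ^ 2 * (3 / L) * (Kc * Real.log N ^ (j ^ 2)) := by
    have htauSum : ∑ n ∈ Finset.Icc 1 N, MeanSquareMajorant.tau j n ^ 2 / n ≤
        Kc * Real.log N ^ (j ^ 2) := by
      rw [hKc]; exact MeanSquareMajorant.sum_tau_sq_div_le j hN2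
    calc ∑ l ∈ S, ‖b l‖ ^ 2
        ≤ ∑ l ∈ S, K ^ 2 * (3 / L) * (MeanSquareMajorant.tau j l ^ 2 / l) :=
          Finset.sum_le_sum hcoef
      _ = K ^ 2 * (3 / L) * ∑ l ∈ S, MeanSquareMajorant.tau j l ^ 2 / l := by
          rw [Finset.mul_sum]
      _ ≤ K ^ 2 * (3 / L) * ∑ n ∈ Finset.Icc 1 N, MeanSquareMajorant.tau j n ^ 2 / n := by
          apply mul_le_mul_of_nonneg_left _ (by positivity)
          apply Finset.sum_le_sum_of_subset_of_nonneg
          · intro n hn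
            have := Finset.mem_Ioc.mp (hSN hn)
            exact Finset.mem_Icc.mpr ⟨this.1, this.2⟩
          · intro n _ _
            exact div_nonneg (sq_nonneg _) (Nat.cast_nonneg _)
      _ ≤ K ^ 2 * (3 / L) * (Kc * Real.log N ^ (j ^ 2)) :=
          mul_le_mul_of_nonneg_left htauSum (by positivity)
  -- sizes of `N`
  have hNle : (N : ℝ) ≤ 4 * Skeleton.bigP D * Skeleton.t0 D * y := Nat.floor_le (by positivity)
  have hNL : (N : ℝ) ≤ 4 * L := by rw [hLdef]; linarith [hNle]
  have hfac : (N : ℝ) + 1 + 18 * R ^ 2 ≤ 19 * (R ^ 2 + L) := by nlinarith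
  have hN1 : (1 : ℝ) ≤ N := by exact_mod_cast le_trans (by norm_num) hN2
  have hlog0 : 0 ≤ Real.log N := Real.log_nonneg hN1
  -- assemble
  calc (∑ r ∈ dyadic R, ∑ θ : DirichletCharacter ℂ r with θ.IsPrimitive,
        ‖∑ l ∈ S, c l * θ (l : ZMod r) * (l : ℂ) ^ (-s)‖ ^ 2)
      = ∑ r ∈ dyadic R, ∑ θ : DirichletCharacter ℂ r with θ.IsPrimitive,
          ‖∑ l ∈ S, b l * θ (l : ZMod r)‖ ^ 2 := hlhs
    _ ≤ ((N : ℝ) + 1 + 18 * R ^ 2) * ∑ l ∈ S, ‖b l‖ ^ 2 := hLS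
    _ ≤ (19 * (R ^ 2 + L)) * (K ^ 2 * (3 / L) * (Kc * Real.log N ^ (j ^ 2))) :=
        mul_le_mul hfac hsumb (Finset.sum_nonneg fun _ _ => by positivity) (by positivity)
    _ = 57 * K ^ 2 * Kc * Real.log N ^ (j ^ 2) * ((R ^ 2 + L) / L) := by
        rw [div_eq_mul_inv, div_eq_mul_inv]; ring

/-- `log⌊4Pt₀y⌋ ≤ 525𝓛⁹` for `1 ≤ y ≤ P` (`P = e^{𝓛⁹}`, `t₀ = 𝓛⁵¹⁹`, `D ≥ 3`): the length of
`𝔌(y) ∩ ℕ` in the ranges of §7 (`y = Rh ≤ P₁`) and §14 (`y = Rh ≤ 2DP₄ ≤ P`).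
[cite: Zhang2022LandauSiegel, §7 p.38, tex L2033] -/
theorem log_natI_length_le {D : ℕ} (hD : 3 ≤ D) {y : ℝ} (hy1 : 1 ≤ y)
    (hy : y ≤ Skeleton.bigP D) :
    Real.log (⌊4 * Skeleton.bigP D * Skeleton.t0 D * y⌋₊ : ℕ) ≤ 525 * Skeleton.ell D ^ 9 := by
  have hℓ1 := one_le_ell hD
  have hP1 := one_le_bigP D
  have hP0 : 0 < Skeleton.bigP D := by linarith
  have hT1 := one_le_t0 hD
  set N : ℕ := ⌊4 * Skeleton.bigP D * Skeleton.t0 D * y⌋₊ with hN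
  by_cases hN0 : N = 0
  · rw [hN0]; simp only [Nat.cast_zero, Real.log_zero]; positivity
  have hN1 : (1 : ℝ) ≤ N := by exact_mod_cast Nat.one_le_iff_ne_zero.mpr hN0
  have hNpos : (0 : ℝ) < N := by linarith
  have hNle : (N : ℝ) ≤ 4 * Skeleton.bigP D * Skeleton.t0 D * y := Nat.floor_le (by positivity)
  have h4L : (N : ℝ) ≤ 4 * Skeleton.bigP D * Skeleton.t0 D * Skeleton.bigP D :=
    hNle.trans (by gcongr)
  have hlog4 : Real.log 4 ≤ 3 := by
    have := Real.log_le_sub_one_of_pos (show (0:ℝ) < 4 by norm_num); linarith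
  have hlogP : Real.log (Skeleton.bigP D) = Skeleton.ell D ^ 9 := by
    rw [Skeleton.bigP, Real.log_exp]
  have hlogT : Real.log (Skeleton.t0 D) ≤ 519 * Skeleton.ell D := by
    rw [Skeleton.t0, Real.log_pow]
    have := Real.log_le_sub_one_of_pos (show 0 < Skeleton.ell D by linarith)
    push_cast; nlinarith
  have hℓ9 : Skeleton.ell D ≤ Skeleton.ell D ^ 9 := le_self_pow₀ hℓ1 (by norm_num)
  have h19 : 1 ≤ Skeleton.ell D ^ 9 := one_le_pow₀ hℓ1
  calc Real.log N ≤ Real.log (4 * Skeleton.bigP D * Skeleton.t0 D * Skeleton.bigP D) :=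
        Real.log_le_log hNpos h4L
    _ = Real.log 4 + Real.log (Skeleton.bigP D) + Real.log (Skeleton.t0 D) +
          Real.log (Skeleton.bigP D) := by
        rw [Real.log_mul (by positivity) hP0.ne', Real.log_mul (by positivity) (by positivity),
          Real.log_mul (by norm_num) hP0.ne']
    _ ≤ 3 + Skeleton.ell D ^ 9 + 519 * Skeleton.ell D + Skeleton.ell D ^ 9 := by
        rw [hlogP]; linarith
    _ ≤ 525 * Skeleton.ell D ^ 9 := by nlinarith

/-- `(R² + Pt₀y)/(Pt₀y) ≤ 2` when `0 ≤ R ≤ y` and `R ≤ P` (`D ≥ 3`) — the second bound of `§7.u039`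
(`R² = R·R ≤ y·P ≤ Pt₀y`). [cite: Zhang2022LandauSiegel, §7 p.39, tex L2047] -/
theorem ratio_natI_le_two {D : ℕ} (hD : 3 ≤ D) {R y : ℝ} (hR : 0 ≤ R) (hRy : R ≤ y)
    (hRP : R ≤ Skeleton.bigP D) :
    (R ^ 2 + Skeleton.bigP D * Skeleton.t0 D * y) / (Skeleton.bigP D * Skeleton.t0 D * y) ≤ 2 := by
  have hP1 := one_le_bigP D
  have hT1 := one_le_t0 hD
  have hy0 : 0 ≤ y := hR.trans hRy
  have hRL : R ^ 2 ≤ Skeleton.bigP D * Skeleton.t0 D * y := by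
    calc R ^ 2 = R * R := sq R
      _ ≤ Skeleton.bigP D * y := mul_le_mul hRP hRy hR (by linarith)
      _ = Skeleton.bigP D * 1 * y := by ring
      _ ≤ Skeleton.bigP D * Skeleton.t0 D * y := by gcongr
  by_cases hL : Skeleton.bigP D * Skeleton.t0 D * y = 0
  · rw [hL, div_zero]; norm_num
  have hL0 : 0 < Skeleton.bigP D * Skeleton.t0 D * y :=
    lt_of_le_of_ne (by positivity) (Ne.symm hL)
  rw [div_le_iff₀ hL0]; linarith

open scoped Classical in
/-- **`§7.u039` generic, in powers of `𝓛`**: under `D ≥ 3`, `1 ≤ R ≤ y ≤ P`, `|c(l)| ≤ Kτ_j(l)` on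
`𝔌(y) ∩ ℕ`, `S ⊆ 𝔌(y) ∩ ℕ`, `σ = 1`:
`Σ_{R≤r<2R} Σ*_{θ mod r} |Σ_{l∈S} c(l)θ(l)l^{−s}|² ≤ 114·525^{j²}·majorantConst(j²,2j)·K²·𝓛^{9j²}`.
[cite: Zhang2022LandauSiegel, §7 p.39, tex L2047] -/
theorem largeSieve_dyadic_natI_ell {D : ℕ} (hD : 3 ≤ D) {R y K : ℝ} (hR : 1 ≤ R) (hRy : R ≤ y)
    (hyP : y ≤ Skeleton.bigP D) (j : ℕ) {c : ℕ → ℂ}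
    (hc : ∀ l ∈ natI D y, ‖c l‖ ≤ K * MeanSquareMajorant.tau j l)
    {S : Finset ℕ} (hS : S ⊆ natI D y) {s : ℂ} (hs : s.re = 1) :
    (∑ r ∈ dyadic R, ∑ θ : DirichletCharacter ℂ r with θ.IsPrimitive,
        ‖∑ l ∈ S, c l * θ (l : ZMod r) * (l : ℂ) ^ (-s)‖ ^ 2) ≤
      114 * 525 ^ (j ^ 2) * MeanSquareMajorant.majorantConst (j ^ 2) (2 * j) * K ^ 2 *
        Skeleton.ell D ^ (9 * j ^ 2) := by
  have hy : 1 ≤ y := hR.trans hRy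
  have hR0 : 0 ≤ R := by linarith
  have hRP : R ≤ Skeleton.bigP D := hRy.trans hyP
  have h1 := largeSieve_dyadic_natI hD hR hy j hc hS hs
  have h2 := log_natI_length_le hD hy hyP
  have h3 := ratio_natI_le_two hD hR0 hRy hRP
  set Kc := MeanSquareMajorant.majorantConst (j ^ 2) (2 * j)
  have hKc0 : 0 < Kc := MeanSquareMajorant.majorantConst_pos _ _
  set N : ℕ := ⌊4 * Skeleton.bigP D * Skeleton.t0 D * y⌋₊
  have hlog0 : 0 ≤ Real.log (N : ℝ) := Real.log_natCast_nonneg N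
  have hratio0 : 0 ≤ (R ^ 2 + Skeleton.bigP D * Skeleton.t0 D * y) /
      (Skeleton.bigP D * Skeleton.t0 D * y) := by
    have := one_le_bigP D; have := one_le_t0 hD; positivity
  have hℓ0 : 0 ≤ Skeleton.ell D := le_trans zero_le_one (one_le_ell hD)
  have hX0 : 0 ≤ 57 * K ^ 2 * Kc * (525 ^ (j ^ 2) * Skeleton.ell D ^ (9 * j ^ 2)) := by positivity
  have hlogpow : Real.log (N : ℝ) ^ (j ^ 2) ≤ 525 ^ (j ^ 2) * Skeleton.ell D ^ (9 * j ^ 2) := by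
    calc Real.log (N : ℝ) ^ (j ^ 2) ≤ (525 * Skeleton.ell D ^ 9) ^ (j ^ 2) :=
          pow_le_pow_left₀ hlog0 h2 _
      _ = 525 ^ (j ^ 2) * Skeleton.ell D ^ (9 * j ^ 2) := by rw [mul_pow, ← pow_mul]
  calc (∑ r ∈ dyadic R, ∑ θ : DirichletCharacter ℂ r with θ.IsPrimitive,
        ‖∑ l ∈ S, c l * θ (l : ZMod r) * (l : ℂ) ^ (-s)‖ ^ 2)
      ≤ 57 * K ^ 2 * Kc * Real.log (N : ℝ) ^ (j ^ 2) *
          ((R ^ 2 + Skeleton.bigP D * Skeleton.t0 D * y) /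
            (Skeleton.bigP D * Skeleton.t0 D * y)) := h1
    _ ≤ 57 * K ^ 2 * Kc * (525 ^ (j ^ 2) * Skeleton.ell D ^ (9 * j ^ 2)) * 2 := by
        gcongr
    _ = 114 * 525 ^ (j ^ 2) * Kc * K ^ 2 * Skeleton.ell D ^ (9 * j ^ 2) := by ring

/-! ## B3: Cauchy's inequality in the index inside the `t`-integral (`§7.u041` generic) -/

/-- **Cauchy's inequality in `(r, θ)` inside `∫ dt/(1+t²)`** (LIB-PLAN B3; the manuscript's "It
follows by Cauchy's inequality that …", §7 p. 39): let `T` be a finite index set and, for `x ∈ T`,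
`F_x, G_x : ℝ → ℝ` non-negative continuous functions whose mean squares are bounded pointwise in `t`,
`Σ_{x∈T} F_x(t)² ≤ A²`, `Σ_{x∈T} G_x(t)² ≤ B²`; if `v(x) ≤ W·∫F_x(t)G_x(t)dt/(1+t²)` for `x ∈ T` then
`Σ_{x∈T} v(x) ≤ π·W·A·B`. (Each integrand is dominated by `AB/(1+t²)`, so integrable; sum and
integral are exchanged; `∫dt/(1+t²) = π`.) [cite: Zhang2022LandauSiegel, §7 p.39, tex L2055] -/
theorem sum_le_of_cauchy_integral {ι : Type*} (T : Finset ι) (F G : ι → ℝ → ℝ) (v : ι → ℝ)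
    {W A B : ℝ} (hW : 0 ≤ W) (hA : 0 ≤ A) (hB : 0 ≤ B)
    (hFc : ∀ x ∈ T, Continuous (F x)) (hGc : ∀ x ∈ T, Continuous (G x))
    (hF0 : ∀ x ∈ T, ∀ t, 0 ≤ F x t) (hG0 : ∀ x ∈ T, ∀ t, 0 ≤ G x t)
    (hFA : ∀ t, ∑ x ∈ T, F x t ^ 2 ≤ A ^ 2) (hGB : ∀ t, ∑ x ∈ T, G x t ^ 2 ≤ B ^ 2)
    (hv : ∀ x ∈ T, v x ≤ W * ∫ t : ℝ, F x t * G x t / (1 + t ^ 2)) :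
    ∑ x ∈ T, v x ≤ Real.pi * W * A * B := by
  -- pointwise bounds for single terms
  have hF : ∀ x ∈ T, ∀ t : ℝ, F x t ≤ A := by
    intro x hx t
    have h1 : F x t ^ 2 ≤ A ^ 2 :=
      le_trans (Finset.single_le_sum (fun y _ => sq_nonneg (F y t)) hx) (hFA t)
    exact le_trans (le_abs_self _) (abs_le_of_sq_le_sq h1 hA)
  have hG : ∀ x ∈ T, ∀ t : ℝ, G x t ≤ B := by
    intro x hx t
    have h1 : G x t ^ 2 ≤ B ^ 2 :=
      le_trans (Finset.single_le_sum (fun y _ => sq_nonneg (G y t)) hx) (hGB t)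
    exact le_trans (le_abs_self _) (abs_le_of_sq_le_sq h1 hB)
  -- Cauchy's inequality in the index, pointwise in `t`
  have hCS : ∀ t : ℝ, ∑ x ∈ T, F x t * G x t ≤ A * B := by
    intro t
    have h1 : (∑ x ∈ T, F x t * G x t) ^ 2 ≤ (A * B) ^ 2 := by
      calc (∑ x ∈ T, F x t * G x t) ^ 2 ≤ (∑ x ∈ T, F x t ^ 2) * ∑ x ∈ T, G x t ^ 2 :=
            Finset.sum_mul_sq_le_sq_mul_sq _ _ _
        _ ≤ A ^ 2 * B ^ 2 :=
            mul_le_mul (hFA t) (hGB t) (Finset.sum_nonneg fun x _ => sq_nonneg _) (sq_nonneg _)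
        _ = (A * B) ^ 2 := by ring
    exact le_trans (le_abs_self _) (abs_le_of_sq_le_sq h1 (mul_nonneg hA hB))
  -- integrability of each integrand
  have hInt : ∀ x ∈ T, Integrable fun t : ℝ => F x t * G x t / (1 + t ^ 2) := by
    intro x hx
    refine Integrable.mono' (integrable_inv_one_add_sq.const_mul (A * B)) ?_ ?_
    · have hc : Continuous fun t : ℝ => F x t * G x t / (1 + t ^ 2) :=
        ((hFc x hx).mul (hGc x hx)).div (by fun_prop) fun t => by positivity
      exact hc.aestronglyMeasurable
    · refine Filter.Eventually.of_forall fun t => ?_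
      have h0 : 0 ≤ F x t * G x t / (1 + t ^ 2) :=
        div_nonneg (mul_nonneg (hF0 x hx t) (hG0 x hx t)) (by positivity)
      rw [Real.norm_of_nonneg h0, div_eq_mul_inv]
      have := hF x hx t
      have := hG x hx t
      have := hG0 x hx t
      have := hF0 x hx t
      gcongr
  -- the chain
  calc ∑ x ∈ T, v x ≤ ∑ x ∈ T, W * ∫ t : ℝ, F x t * G x t / (1 + t ^ 2) :=
        Finset.sum_le_sum hv
    _ = W * ∫ t : ℝ, ∑ x ∈ T, F x t * G x t / (1 + t ^ 2) := by
        rw [← Finset.mul_sum, integral_finsetSum _ hInt]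
    _ ≤ W * ∫ t : ℝ, A * B * (1 + t ^ 2)⁻¹ := by
        refine mul_le_mul_of_nonneg_left ?_ hW
        refine integral_mono_of_nonneg (Filter.Eventually.of_forall fun t =>
          Finset.sum_nonneg fun x hx =>
            div_nonneg (mul_nonneg (hF0 x hx t) (hG0 x hx t)) (by positivity))
          (integrable_inv_one_add_sq.const_mul (A * B))
          (Filter.Eventually.of_forall fun t => ?_)
        have h1t : 0 < 1 + t ^ 2 := by positivity
        calc ∑ x ∈ T, F x t * G x t / (1 + t ^ 2)
            = (∑ x ∈ T, F x t * G x t) / (1 + t ^ 2) := by rw [Finset.sum_div]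
          _ ≤ A * B / (1 + t ^ 2) := by gcongr; exact hCS t
          _ = A * B * (1 + t ^ 2)⁻¹ := div_eq_mul_inv _ _
    _ = W * (A * B * Real.pi) := by
        rw [integral_const_mul, integral_univ_inv_one_add_sq]
    _ = Real.pi * W * A * B := by ring

/-- The shape of the large-sieve main term: `√((R²+P)P³) ≤ R·P^{3/2} + P²` (`R, P ≥ 0`).
[cite: Zhang2022LandauSiegel, §7 p.39, tex L2055] -/
theorem sqrt_largeSieve_main_le {R P : ℝ} (hR : 0 ≤ R) (hP : 0 ≤ P) :
    Real.sqrt ((R ^ 2 + P) * P ^ 3) ≤ R * P ^ (3 / 2 : ℝ) + P ^ 2 := by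
  have hP32 : (P ^ (3 / 2 : ℝ)) ^ 2 = P ^ 3 := by
    rw [← Real.rpow_natCast _ 2, ← Real.rpow_mul hP,
      show (3 / 2 : ℝ) * ((2 : ℕ) : ℝ) = ((3 : ℕ) : ℝ) by norm_num, Real.rpow_natCast]
  have h0 : 0 ≤ R * P ^ (3 / 2 : ℝ) + P ^ 2 := by positivity
  rw [Real.sqrt_le_left h0]
  have hx : 0 ≤ R * P ^ (3 / 2 : ℝ) * P ^ 2 := by positivity
  nlinarith [hP32, hx]

/-- With a constant: `√(C(R²+P)P³) ≤ √C·(R·P^{3/2} + P²)` (`C, R, P ≥ 0`).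
[cite: Zhang2022LandauSiegel, §7 p.39, tex L2055] -/
theorem sqrt_const_largeSieve_main_le {C R P : ℝ} (hC : 0 ≤ C) (hR : 0 ≤ R) (hP : 0 ≤ P) :
    Real.sqrt (C * (R ^ 2 + P) * P ^ 3) ≤ Real.sqrt C * (R * P ^ (3 / 2 : ℝ) + P ^ 2) := by
  have hX : 0 ≤ (R ^ 2 + P) * P ^ 3 := by positivity
  calc Real.sqrt (C * (R ^ 2 + P) * P ^ 3) = Real.sqrt (C * ((R ^ 2 + P) * P ^ 3)) := by
        rw [mul_assoc]
    _ = Real.sqrt C * Real.sqrt ((R ^ 2 + P) * P ^ 3) := Real.sqrt_mul hC _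
    _ ≤ Real.sqrt C * (R * P ^ (3 / 2 : ℝ) + P ^ 2) := by
        gcongr; exact sqrt_largeSieve_main_le hR hP

/-- The `R`-power bookkeeping of (7.15)/(14.8):
`R^{−3/2}·R·(R·P^{3/2} + P²) = R^{1/2}P^{3/2} + R^{−1/2}P²` (`R > 0`).
[cite: Zhang2022LandauSiegel, §7 p.39, tex L2055] -/
theorem rpow_neg_three_halves_mul {R P : ℝ} (hR : 0 < R) :
    R ^ (-(3 / 2 : ℝ)) * R * (R * P ^ (3 / 2 : ℝ) + P ^ 2) =
      R ^ (1 / 2 : ℝ) * P ^ (3 / 2 : ℝ) + R ^ (-(1 / 2 : ℝ)) * P ^ 2 := by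
  have h1 : R ^ (-(3 / 2 : ℝ)) * R = R ^ (-(1 / 2 : ℝ)) := by
    rw [← Real.rpow_add_one hR.ne']; norm_num
  have h2 : R ^ (-(1 / 2 : ℝ)) * R = R ^ (1 / 2 : ℝ) := by
    rw [← Real.rpow_add_one hR.ne']; norm_num
  calc R ^ (-(3 / 2 : ℝ)) * R * (R * P ^ (3 / 2 : ℝ) + P ^ 2)
      = (R ^ (-(3 / 2 : ℝ)) * R * R) * P ^ (3 / 2 : ℝ) + (R ^ (-(3 / 2 : ℝ)) * R) * P ^ 2 := by
        ring
    _ = R ^ (1 / 2 : ℝ) * P ^ (3 / 2 : ℝ) + R ^ (-(1 / 2 : ℝ)) * P ^ 2 := by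
        rw [h1, h2]

end Literature.NumberTheory.LFunctions.Zhang2022.BErrorChain
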